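import Summits.HubbardSuperconductivity.HubbardSuperconductivity.Theses.AnomalyExhaustion
import Summits.HubbardSuperconductivity.HubbardSuperconductivity.Theorems.TwTipContinuation.Negative.TipNormalForm

/-!
# Route `AnomalyExhaustion` — the glue items

* `EvenSubsequenceReduction` (stmt-HubbardSuperconductivity-1459): if the summit's even-side LRO
  conclusion fails for a family `ψ_L` normalised at even sides, some strictly increasing `M` with
  all `M j + 1` even has `(M j+1)⁻⁴ Re⟨ψ_{M j+1}, Δ_d†Δ_d ψ_{M j+1}⟩ → 0`: the LRO sequence
  `u_k` is non-negative (`lroTerm_nonneg`) and bounded (`expect_pairIntensity_le`), so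
  `liminf u ≤ 0` makes `u_k < 1/(n+1)` frequent for every `n`; extract
  (`Filter.extraction_forall_of_frequently`) and put `M j := 2 k_j - 1`.
* `Assembly` (stmt-HubbardSuperconductivity-1460): `EtsTrichotomy → NoFermiArc → NoDensityWave →
  CondensateIsDWave → HubbardSuperconductivity` at `δ := √2/5` (irrational, in `(0, 7/20)`),
  `U := U₀/2` with `U₀` the minimum of the three thresholds: along the even subsequence of a
  putative LRO failure the d-wave density tends to `0`, so `CondensateIsDWave` kills branch (A),
  `NoDensityWave` (with `c/2`) kills (B), `NoFermiArc` is `¬(C)` — contradicting the trichotomy.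

Sources: D. J. Scalapino, Phys. Rep. 250 (1995) 329, §2; C. N. Yang, Rev. Mod. Phys. 34 (1962) 694,
§4; D. V. Else, R. Thorngren, T. Senthil, Phys. Rev. X 11 (2021) 021005, Thm 1. No new definitions.
-/

-- the mandated namespace `Summit.<Summit>.<Problem>.Theorems` repeats `HubbardSuperconductivity`
-- (single-problem summit, D-0017), which the `dupNamespace` linter flags on every declaration
set_option linter.dupNamespace false

namespace Summit.HubbardSuperconductivity.HubbardSuperconductivity.Theorems.AnomalyExhaustion

open Matrix Filter Topology Literature.MathematicalPhysics.QuantumLattice Literature.Probability.LatticeModels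
open Summit.HubbardSuperconductivity.HubbardSuperconductivity.Theses.AnomalyExhaustion
open Summit.HubbardSuperconductivity.TwTipContinuation.Negative
  (lroTerm_eq lroTerm_nonneg expect_pairIntensity_le side_pow_pos sum_torusPullback_two sum_pairFieldCorr)

/-- **`EvenSubsequenceReduction`** (stmt-HubbardSuperconductivity-1459): for a family `ψ_L`
normalised at even sides, failure of the even-side `d`-wave LRO conclusion yields a strictly
increasing `M` with every `M j + 1` even and `(M j+1)⁻⁴ Re⟨ψ_{M j+1}, Δ_d†Δ_d ψ_{M j+1}⟩ → 0`.
The LRO sequence is non-negative and bounded by the a-priori cap, so `liminf ≤ 0` makes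
`u_k < 1/(n+1)` (with `k ≥ 1`) frequent for every `n`; a diagonal extraction `k_j` gives
`M j := 2k_j - 1`, and `u_{k_j} = (2k_j)⁻⁴ Re⟨ψ_{2k_j}, Δ_d†Δ_d ψ_{2k_j}⟩` (`lroTerm_eq`).
Scalapino, Phys. Rep. 250 (1995) 329, §2. [folklore] -/
theorem evenSubsequenceReduction_proof :
    Summit.HubbardSuperconductivity.HubbardSuperconductivity.Theses.AnomalyExhaustion.EvenSubsequenceReduction := by
  unfold EvenSubsequenceReduction
  intro ψ hnorm hnot
  -- the LRO sequence
  set u : ℕ → ℝ := fun k => (∑ x ∈ halfOpenBox 2 (2 * k), ∑ y ∈ halfOpenBox 2 (2 * k),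
      torusPullback (pairFieldCorr dWaveFormFactor ψ) (2 * k) x y) /
    ((halfOpenBox 2 (2 * k)).card : ℝ) ^ 2 with hu
  set C : ℝ := (∑ e ∈ insert 0 unitSteps, ‖((dWaveFormFactor e / Real.sqrt 2 : ℝ) : ℂ)‖ * 2) ^ 2
    with hC
  have hu0 : ∀ k, 0 ≤ u k := fun k => lroTerm_nonneg ψ k
  have hC0 : 0 ≤ C := by rw [hC]; positivity
  have huB : ∀ k, u k ≤ C := by
    intro k
    rcases Nat.eq_zero_or_pos k with rfl | hk
    · simp [hu, card_halfOpenBox, hC0]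
    · haveI : NeZero (2 * k) := ⟨by omega⟩
      show (∑ x ∈ halfOpenBox 2 (2 * k), ∑ y ∈ halfOpenBox 2 (2 * k),
          torusPullback (pairFieldCorr dWaveFormFactor ψ) (2 * k) x y) /
        ((halfOpenBox 2 (2 * k)).card : ℝ) ^ 2 ≤ C
      rw [lroTerm_eq, div_le_iff₀ (side_pow_pos k)]
      exact expect_pairIntensity_le (2 * k) (ψ (2 * k)) (hnorm (2 * k) (even_two_mul k))
  have hlim : liminf u atTop ≤ 0 := by
    change ¬ (0 < liminf u atTop) at hnot
    exact not_lt.mp hnot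
  -- `u_k < 1/(n+1)` with `k ≥ 1` is frequent, for every `n`
  have hfreq : ∀ n : ℕ, ∃ᶠ k in atTop, u k < 1 / ((n : ℝ) + 1) ∧ 1 ≤ k := by
    intro n
    have h1 : liminf u atTop < 1 / ((n : ℝ) + 1) := lt_of_le_of_lt hlim (by positivity)
    have hf : ∃ᶠ k in atTop, u k < 1 / ((n : ℝ) + 1) :=
      frequently_lt_of_liminf_lt (isCoboundedUnder_ge_of_le atTop huB) h1
    exact hf.and_eventually (eventually_ge_atTop 1)
  obtain ⟨φ, hφmono, hφP⟩ := extraction_forall_of_frequently hfreq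
  refine ⟨fun j => 2 * φ j - 1, fun a b hab => ?_, fun j => ?_, ?_⟩
  · have := hφmono hab
    have h1a := (hφP a).2
    show 2 * φ a - 1 < 2 * φ b - 1
    omega
  · have h1 := (hφP j).2
    show Even (2 * φ j - 1 + 1)
    rw [show 2 * φ j - 1 + 1 = 2 * φ j by omega]
    exact even_two_mul _
  · -- identify the subsequence values with `u (φ j)` and squeeze
    -- the instance-free LRO sequence indexed by the side, and the density at sides `n + 1`
    set V : ℕ → ℝ := fun L => (∑ x ∈ halfOpenBox 2 L, ∑ y ∈ halfOpenBox 2 L,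
        torusPullback (pairFieldCorr dWaveFormFactor ψ) L x y) /
      ((halfOpenBox 2 L).card : ℝ) ^ 2 with hV
    set G : ℕ → ℝ := fun n => (expect ((pairField dWaveFormFactor (n + 1))ᴴ *
        pairField dWaveFormFactor (n + 1)) (ψ (n + 1))).re / (((n + 1 : ℕ)) : ℝ) ^ 4 with hG
    have hGV : ∀ n, G n = V (n + 1) := fun n => by
      simp only [hG, hV]
      rw [sum_torusPullback_two, sum_pairFieldCorr]
    have huV : ∀ k, u k = V (2 * k) := fun k => rfl
    show Tendsto (fun j => G (2 * φ j - 1)) atTop (𝓝 0)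
    have hval : ∀ j, G (2 * φ j - 1) = u (φ j) := fun j => by
      have h1 := (hφP j).2
      rw [hGV, huV, show 2 * φ j - 1 + 1 = 2 * φ j by omega]
    have h0 : Tendsto (fun j : ℕ => 1 / ((j : ℝ) + 1)) atTop (𝓝 0) :=
      tendsto_one_div_add_atTop_nhds_zero_nat
    refine tendsto_of_tendsto_of_tendsto_of_le_of_le tendsto_const_nhds h0 (fun j => ?_)
      (fun j => ?_)
    · show (0 : ℝ) ≤ G (2 * φ j - 1)
      rw [hval]; exact hu0 _
    · show G (2 * φ j - 1) ≤ 1 / ((j : ℝ) + 1)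
      rw [hval]; exact (hφP j).1.le

/-- **Assembly of route `AnomalyExhaustion`** (stmt-HubbardSuperconductivity-1460):
`EtsTrichotomy → NoFermiArc → NoDensityWave → CondensateIsDWave → HubbardSuperconductivity`.
Take `δ := √2/5` (irrational, in `(0, 7/20) ⊂ (0, 1/2)`), `U₀` the minimum of the three
weak-coupling thresholds at `δ`, `U := U₀/2`, and `c > 0` from `CondensateIsDWave`. If a summit
family `(N, ψ)` at `(U, δ)` had no even-side LRO, `evenSubsequenceReduction_proof` gives a strictly
increasing `M` (even sides `M j + 1`) with `d_j := (M j+1)⁻⁴ Re⟨Δ_d†Δ_d⟩ → 0`, and the family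
`j ↦ ψ (M j+1)` satisfies the common hypothesis block. Branch (A) of the trichotomy (a pair
condensate `c' L² ≤ λ_max(ρ₂)` frequently) contradicts `c λ_max/L² ≤ d_j + c c'/4` eventually;
branch (B) (a density wave `c' L⁴ ≤ S_d(q)` frequently) contradicts `NoDensityWave` with `c'/2`;
branch (C) is excluded by `NoFermiArc`. Scalapino, Phys. Rep. 250 (1995) 329, §2; Yang, Rev. Mod.
Phys. 34 (1962) 694, §4; Else–Thorngren–Senthil, Phys. Rev. X 11 (2021) 021005, Thm 1. [folklore] -/
theorem anomalyExhaustion_assembly_proof :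
    Summit.HubbardSuperconductivity.HubbardSuperconductivity.Theses.AnomalyExhaustion.Assembly := by
  unfold Assembly
  intro hE hF hD hC
  -- the doping `δ = √2 / 5`
  have hsqrt : Real.sqrt 2 < 3 / 2 := by
    rw [Real.sqrt_lt' (by norm_num)]; norm_num
  have hirr : Irrational (Real.sqrt 2 / 5) := by
    have h := irrational_sqrt_two.div_natCast (m := 5) (by norm_num)
    exact_mod_cast h
  set δ : ℝ := Real.sqrt 2 / 5 with hδdef
  have hδpos : 0 < δ := by positivity
  have hδa : δ ∈ Set.Ioo (0 : ℝ) (1 / 2) := ⟨hδpos, by rw [hδdef]; linarith⟩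
  have hδb : δ ∈ Set.Ioo (0 : ℝ) (7 / 20) := ⟨hδpos, by rw [hδdef]; linarith⟩
  -- the thresholds
  unfold NoFermiArc at hF
  unfold NoDensityWave at hD
  unfold CondensateIsDWave at hC
  unfold EtsTrichotomy at hE
  obtain ⟨U₁, hU₁, hF'⟩ := hF δ hδa
  obtain ⟨U₂, hU₂, hD'⟩ := hD δ hδa
  obtain ⟨U₃, hU₃, hC'⟩ := hC δ hδb
  have hm : 0 < min U₁ (min U₂ U₃) := lt_min hU₁ (lt_min hU₂ hU₃)
  set U : ℝ := min U₁ (min U₂ U₃) / 2 with hUdef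
  have hUpos : 0 < U := by positivity
  have hUlt : U < min U₁ (min U₂ U₃) := half_lt_self hm
  have hU1 : U ∈ Set.Ioo (0 : ℝ) U₁ := ⟨hUpos, lt_of_lt_of_le hUlt (min_le_left _ _)⟩
  have hU2 : U ∈ Set.Ioo (0 : ℝ) U₂ :=
    ⟨hUpos, (lt_of_lt_of_le hUlt (min_le_right _ _)).trans_le (min_le_left _ _)⟩
  have hU3 : U ∈ Set.Ioo (0 : ℝ) U₃ :=
    ⟨hUpos, (lt_of_lt_of_le hUlt (min_le_right _ _)).trans_le (min_le_right _ _)⟩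
  obtain ⟨c, hc, hC''⟩ := hC' U hU3
  unfold _root_.HubbardSuperconductivity Literature.Hubbard.DWaveSuperconductivityHubbard
  refine ⟨U, hUpos, δ, hδa, fun N ψ hyp => ?_⟩
  by_contra hnot
  obtain ⟨M, hM, hMeven, htend⟩ :=
    evenSubsequenceReduction_proof ψ (fun L hL => (hyp L hL).2.1) hnot
  -- the even subsequence family and its hypothesis block
  have hblock : StrictMono M ∧ ∀ j, Even (M j + 1) ∧ star (ψ (M j + 1)) ⬝ᵥ ψ (M j + 1) = 1 ∧
      IsGroundStateInSector (hubbardTorus 2 (M j + 1) 1 U)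
        (2 * ⌊(1 - δ) * ((M j + 1 : ℕ) : ℝ) ^ 2 / 2⌋₊) 0 (ψ (M j + 1)) := by
    refine ⟨hM, fun j => ⟨hMeven j, ?_⟩⟩
    obtain ⟨hN, hn, hgs⟩ := hyp (M j + 1) (hMeven j)
    rw [hN] at hgs
    exact ⟨hn, hgs⟩
  have hEt := hE U δ M (fun j => ψ (M j + 1)) hUpos hδa hirr hblock
  have hFa := hF' U M (fun j => ψ (M j + 1)) hU1 hblock
  have hDa := hD' U M (fun j => ψ (M j + 1)) hU2 hblock
  have hCa := hC'' M (fun j => ψ (M j + 1)) hblock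
  dsimp only at hEt hFa hDa hCa
  rcases hEt with hA | hB | hCbr
  · -- (A): a pair condensate along the subsequence, against a vanishing d-wave density
    obtain ⟨c', hc', hfreqA⟩ := hA
    have hcc : 0 < c * c' := mul_pos hc hc'
    have hη : 0 < c * c' / 4 := by positivity
    have hev1 := hCa (c * c' / 4) hη
    have hev2 := htend.eventually (eventually_lt_nhds hη)
    obtain ⟨j, hjA, hj1, hj2⟩ := (hfreqA.and_eventually (hev1.and hev2)).exists
    have hL2 : (0 : ℝ) < ((M j + 1 : ℕ) : ℝ) ^ 2 := by positivity
    have h1 : c * c' ≤ c * (twoParticleRDM (ψ (M j + 1))).supRayleigh / ((M j + 1 : ℕ) : ℝ) ^ 2 := by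
      rw [mul_div_assoc]
      refine mul_le_mul_of_nonneg_left ?_ hc.le
      rw [le_div_iff₀ hL2]
      exact hjA
    linarith
  · -- (B): a particle-hole density wave along the subsequence, against `NoDensityWave` with `c'/2`
    obtain ⟨R, a, c', hc', hfreqB⟩ := hB
    have hevD := hDa R a (c' / 2) (by positivity)
    obtain ⟨j, ⟨q, hq, hqB⟩, hjD⟩ := (hfreqB.and_eventually hevD).exists
    have hle := hjD q hq
    have hL4 : (0 : ℝ) < ((M j + 1 : ℕ) : ℝ) ^ 4 := by positivity
    nlinarith
  · -- (C): an arc of quasiparticle discontinuities, excluded by `NoFermiArc`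
    exact hFa hCbr

end Summit.HubbardSuperconductivity.HubbardSuperconductivity.Theorems.AnomalyExhaustion
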